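import Literature.Analysis.FluidPDE.AxisymmetricVorticityTransport
import Literature.Analysis.FluidPDE.MeridianReduction
import HarnessLib

/-!
# Chen–Hou's `(θ̃, ω̃)` system on the meridian half-plane, derived from the 3D Euler equations

Analysis/FluidPDE support file on the decomposition path of `Literature.Analysis.FluidPDE.chen_hou_blowup`. Chen–Hou
(Part I, §6, p. 53) write the axisymmetric Euler equations for the meridian profiles of
`θ̃ = (r u^θ)²` and `ω̃ = ω^θ / r` as the transport system (6.5)–(6.6),

  `∂ₜθ̃ + u^r θ̃_r + u^z θ̃_z = 0`,  `∂ₜω̃ + u^r ω̃_r + u^z ω̃_z = r⁻⁴ ∂_z θ̃`,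

in the variables `(r, z)`. `AxisymmetricVorticityTransport` derives these equations for the
corresponding scalar fields on `ℝ³` (off the axis) from the velocity–pressure formulation of a
classical unforced Euler solution with axisymmetric velocity; `MeridianReduction` identifies
axisymmetric scalars with functions of `(r, z)` and the material derivative with
`∂ₜ + u^r ∂ᵣ + u^z ∂_z`. This file puts the two together: for the **meridian profiles**

* `Θ t (r, z) = Γ(t, (r,0,z))²` (`= θ̃`, `Γ = r u_θ = swirl`),
* `W t (r, z) = Ω(t, (r,0,z)) / r²` (`= ω̃ = ω_θ/r`, `Ω = r ω_θ = swirl (curl u)`),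
* `U^r t (r, z)`, `U^z t (r, z)` the radial and axial velocity at `(r, 0, z)`,

of a classical unforced Euler solution on `ℝ³ × S` (`S ⊆ closure (interior S)` of unique
differentiability) with axisymmetric velocity, and every `(r, z)` with `r > 0`,
`∂ₜΘ + DΘ(U^r, U^z) = 0` and `∂ₜW + DW(U^r, U^z) = r⁻⁴ ∂_zΘ`
(`IsClassicalEulerSolutionOn.chenHou_meridian_thetaTilde`, `…_omegaTilde`), literally (6.6) with
`DΘ(U^r, U^z) = U^r ∂ᵣΘ + U^z ∂_zΘ`. Orientation: right-handed `e_θ` (see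
`AxisymmetricVorticityTransport`); whole-space classical solutions (the tree's
`IsClassicalNSSolutionOn`), the cylinder version being the same computation at interior points.

All statements are folklore calculus. [cite: arXiv221007191, §6 (6.5)–(6.6) p. 53]
-/

noncomputable section

open Set Function Filter Topology WithLp
open scoped InnerProductSpace RealInnerProductSpace ContDiff

namespace Literature.Analysis.FluidPDE

/-- Local notation for physical space `ℝ³ = EuclideanSpace ℝ (Fin 3)`. -/
local notation "ℝ³" => EuclideanSpace ℝ (Fin 3)

section Meridian

variable {S : Set ℝ} {u : ℝ → ℝ³ → ℝ³} {p : ℝ → ℝ³ → ℝ}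

/-- The meridian point `(r, 0, z)` of `q = (r, z)` with `r ≠ 0` is off the axis:
`cylRadius (meridianPoint q) = r` for `r ≥ 0`. [folklore] -/
theorem cylRadius_meridianPoint {q : ℝ × ℝ} (hq : 0 ≤ q.1) : cylRadius (meridianPoint q) = q.1 :=
  congrArg Prod.fst (meridian_meridianPoint hq)

/-- The derivative of a function of `(r, z)` along `(a, b)` in terms of the partial derivatives:
`DG(q)(a, b) = a ∂ᵣG(q) + b ∂_zG(q)` with `∂ᵣG = DG(1,0)`, `∂_zG = DG(0,1)` (so that
`DΘ(U^r, U^z)` below reads `U^r ∂ᵣΘ + U^z ∂_zΘ`, verbatim (6.6)). [folklore] -/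
theorem fderiv_prod_apply_eq {F : Type*} [NormedAddCommGroup F] [NormedSpace ℝ F]
    (G : ℝ × ℝ → F) (q : ℝ × ℝ) (a b : ℝ) :
    fderiv ℝ G q (a, b) = a • fderiv ℝ G q (1, 0) + b • fderiv ℝ G q (0, 1) := by
  have : ((a, b) : ℝ × ℝ) = a • ((1 : ℝ), (0 : ℝ)) + b • ((0 : ℝ), (1 : ℝ)) := by
    ext <;> simp
  rw [this, map_add, map_smul, map_smul]

/-- **Chen–Hou (6.6), first equation, for the meridian profile `Θ = θ̃ = (r u^θ)²`.** For a
classical unforced Euler solution on `ℝ³ × S` (`S` of unique differentiability) with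
axisymmetric velocity, `t ∈ S` and `r > 0`:
`∂ₜΘ(t)(r,z) + DΘ(t)(r,z)(U^r, U^z) = 0`, where `Θ t (r,z) = (swirl (u t) (r,0,z))²` and
`U^r, U^z` are the radial and axial velocity at `(r, 0, z)`; `DΘ(U^r,U^z) = U^r∂ᵣΘ + U^z∂_zΘ`
(Part I, (6.5)–(6.6), p. 53). [cite: arXiv221007191, §6 (6.6) p. 53] -/
theorem IsClassicalEulerSolutionOn.chenHou_meridian_thetaTilde (h : IsClassicalEulerSolutionOn S 0 u p)
    (hS : UniqueDiffOn ℝ S) (hu : ∀ t ∈ S, IsAxisymmetric (u t)) {t : ℝ} (ht : t ∈ S)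
    {q : ℝ × ℝ} (hq : 0 < q.1) :
    timeDerivWithin S (fun s q' => swirl (u s) (meridianPoint q') ^ 2) t q +
      fderiv ℝ (fun q' => swirl (u t) (meridianPoint q') ^ 2) q
        (radialVelocity (u t) (meridianPoint q), axialVelocity (u t) (meridianPoint q)) = 0 := by
  set x : ℝ³ := meridianPoint q with hx_def
  have hr : cylRadius x = q.1 := cylRadius_meridianPoint hq.le
  have hx : cylRadius x ≠ 0 := by rw [hr]; exact hq.ne'
  have hmx : meridian x = q := meridian_meridianPoint hq.le
  -- the scalar field `θ̃ = Γ²` and its meridian profile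
  have hax : ∀ s ∈ S, IsAxisymmetricScalar fun y => swirl (u s) y ^ 2 := fun s hs θ y => by
    show swirl (u s) (rotZ θ y) ^ 2 = swirl (u s) y ^ 2
    rw [(hu s hs).swirl_rotZ]
  have hgG : ∀ s ∈ S, ∀ y, swirl (u s) y ^ 2 =
      (fun s q' => swirl (u s) (meridianPoint q') ^ 2) s (meridian y) := fun s hs y =>
    (hax s hs).eq_comp_meridian y
  have hsm : ∀ s ∈ S, ContDiff ℝ ∞ (fun q' : ℝ × ℝ => swirl (u s) (meridianPoint q') ^ 2) := fun s hs =>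
    ((contDiff_swirl (h.contDiff_velocity hs)).pow 2).comp contDiff_meridianPoint
  -- the time derivative of `θ̃` at `x` is that of its meridian profile at `meridian x`
  -- (`timeDerivWithin_congr_on`, definitionally)
  have hT : timeDerivWithin S (fun s y => swirl (u s) y ^ 2) t x =
      timeDerivWithin S (fun s q' => swirl (u s) (meridianPoint q') ^ 2) t (meridian x) :=
    timeDerivWithin_congr_on hgG ht x
  have hE := h.chenHou_thetaTilde_transport hS hu ht hx
  rw [hT,
    show (fun y => swirl (u t) y ^ 2) = fun y =>
        (fun q' : ℝ × ℝ => swirl (u t) (meridianPoint q') ^ 2) (meridian y) from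
      funext fun y => hgG t ht y,
    convect_comp_meridian hx (((hsm t ht).differentiable (by simp)) _), hmx] at hE
  exact hE

/-- Verbatim form of (6.6), first equation: `∂ₜΘ + U^r ∂ᵣΘ + U^z ∂_zΘ = 0` for the meridian
profile `Θ = θ̃` (`∂ᵣ = D(·)(1,0)`, `∂_z = D(·)(0,1)`). [cite: arXiv221007191, §6 (6.6) p. 53] -/
theorem IsClassicalEulerSolutionOn.chenHou_meridian_thetaTilde' (h : IsClassicalEulerSolutionOn S 0 u p)
    (hS : UniqueDiffOn ℝ S) (hu : ∀ t ∈ S, IsAxisymmetric (u t)) {t : ℝ} (ht : t ∈ S)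
    {q : ℝ × ℝ} (hq : 0 < q.1) :
    timeDerivWithin S (fun s q' => swirl (u s) (meridianPoint q') ^ 2) t q +
      radialVelocity (u t) (meridianPoint q) *
        fderiv ℝ (fun q' => swirl (u t) (meridianPoint q') ^ 2) q (1, 0) +
      axialVelocity (u t) (meridianPoint q) *
        fderiv ℝ (fun q' => swirl (u t) (meridianPoint q') ^ 2) q (0, 1) = 0 := by
  have hE := h.chenHou_meridian_thetaTilde hS hu ht hq
  rw [fderiv_prod_apply_eq] at hE
  simpa only [smul_eq_mul, add_assoc] using hE

/-- **Chen–Hou (6.6), second equation, for the meridian profile `W = ω̃ = ω^θ/r`.** For a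
classical unforced Euler solution on `ℝ³ × S` (`S ⊆ closure (interior S)` of unique
differentiability) with axisymmetric velocity, `t ∈ S` and `r > 0`:
`∂ₜW(t)(r,z) + DW(t)(r,z)(U^r, U^z) = r⁻⁴ ∂_zΘ(t)(r,z)`, where
`W t (r,z) = swirl (curl (u t)) (r,0,z) / r²` (`= Ω/r² = ω_θ/r`),
`Θ t (r,z) = (swirl (u t) (r,0,z))²`, `∂_zΘ = DΘ(0,1)`, and `U^r, U^z` are the radial and axial
velocity at `(r, 0, z)` (Part I, (6.5)–(6.6), p. 53; right-handed `e_θ`). [cite: arXiv221007191, §6 (6.6) p. 53] -/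
theorem IsClassicalEulerSolutionOn.chenHou_meridian_omegaTilde (h : IsClassicalEulerSolutionOn S 0 u p)
    (hS : UniqueDiffOn ℝ S) (hcl : S ⊆ closure (interior S)) (hu : ∀ t ∈ S, IsAxisymmetric (u t))
    {t : ℝ} (ht : t ∈ S) {q : ℝ × ℝ} (hq : 0 < q.1) :
    timeDerivWithin S (fun s q' => swirl (curl (u s)) (meridianPoint q') * (q'.1 ^ 2)⁻¹) t q +
      fderiv ℝ (fun q' => swirl (curl (u t)) (meridianPoint q') * (q'.1 ^ 2)⁻¹) q
        (radialVelocity (u t) (meridianPoint q), axialVelocity (u t) (meridianPoint q)) =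
      (q.1 ^ 4)⁻¹ * fderiv ℝ (fun q' => swirl (u t) (meridianPoint q') ^ 2) q (0, 1) := by
  set x : ℝ³ := meridianPoint q with hx_def
  have hr : cylRadius x = q.1 := cylRadius_meridianPoint hq.le
  have hx : cylRadius x ≠ 0 := by rw [hr]; exact hq.ne'
  have hmx : meridian x = q := meridian_meridianPoint hq.le
  have hdiff : ∀ s ∈ S, Differentiable ℝ (u s) := fun s hs =>
    (h.contDiff_velocity hs).differentiable (by simp)
  -- `ω̃ = Ω / r²` is an axisymmetric scalar with meridian profile `W`
  have haxΩ : ∀ s ∈ S, IsAxisymmetricScalar (swirl (curl (u s))) := fun s hs =>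
    (hu s hs).isAxisymmetricScalar_swirl_curl (hdiff s hs)
  have hgG : ∀ s ∈ S, ∀ y, swirl (vorticity u s) y * (cylRadius y ^ 2)⁻¹ =
      (fun s q' => swirl (curl (u s)) (meridianPoint q') * (q'.1 ^ 2)⁻¹) s (meridian y) := by
    intro s hs y
    show swirl (curl (u s)) y * (cylRadius y ^ 2)⁻¹ =
      swirl (curl (u s)) (meridianPoint (meridian y)) * ((meridian y).1 ^ 2)⁻¹
    rw [← (haxΩ s hs).eq_comp_meridian y, meridian_apply]
  -- `θ̃` likewise
  have haxΘ : ∀ s ∈ S, IsAxisymmetricScalar fun y => swirl (u s) y ^ 2 := fun s hs θ y => by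
    show swirl (u s) (rotZ θ y) ^ 2 = swirl (u s) y ^ 2
    rw [(hu s hs).swirl_rotZ]
  have hΘ : (fun y => swirl (u t) y ^ 2) = fun y =>
      (fun q' : ℝ × ℝ => swirl (u t) (meridianPoint q') ^ 2) (meridian y) :=
    funext fun y => (haxΘ t ht).eq_comp_meridian y
  have hsmΘ : ContDiff ℝ ∞ (fun q' : ℝ × ℝ => swirl (u t) (meridianPoint q') ^ 2) :=
    ((contDiff_swirl (h.contDiff_velocity ht)).pow 2).comp contDiff_meridianPoint
  -- differentiability of the profile `W t` at `q` (`r ≠ 0`)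
  have hΩ2 : ContDiff ℝ 2 (swirl (curl (u t))) :=
    contDiff_swirl (contDiff_curl (n := 2) ((h.contDiff_velocity ht).of_le (by norm_cast)))
  have hWd : DifferentiableAt ℝ
      (fun q' : ℝ × ℝ => swirl (curl (u t)) (meridianPoint q') * (q'.1 ^ 2)⁻¹) (meridian x) := by
    rw [hmx]
    refine DifferentiableAt.mul ?_ ?_
    · exact ((hΩ2.comp contDiff_meridianPoint).differentiable (by norm_num)) q
    · exact (differentiableAt_fst.pow 2).inv (pow_ne_zero 2 hq.ne')
  -- the time derivative of `ω̃` at `x` is that of its meridian profile `W` at `meridian x`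
  have hT : timeDerivWithin S (fun s y => swirl (vorticity u s) y * (cylRadius y ^ 2)⁻¹) t x =
      timeDerivWithin S (fun s q' => swirl (curl (u s)) (meridianPoint q') * (q'.1 ^ 2)⁻¹) t
        (meridian x) :=
    timeDerivWithin_congr_on hgG ht x
  have hE := h.chenHou_omegaTilde_transport hS hcl hu ht hx
  rw [hT,
    show (fun y => swirl (vorticity u t) y * (cylRadius y ^ 2)⁻¹) = fun y =>
        (fun q' : ℝ × ℝ => swirl (curl (u t)) (meridianPoint q') * (q'.1 ^ 2)⁻¹) (meridian y) from
      funext fun y => hgG t ht y,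
    convect_comp_meridian hx hWd, hΘ,
    partialDeriv_eZ_comp_meridian hx ((hsmΘ.differentiable (by simp)) _), hmx, hr] at hE
  exact hE

/-- Verbatim form of (6.6), second equation: `∂ₜW + U^r ∂ᵣW + U^z ∂_zW = r⁻⁴ ∂_zΘ` for the
meridian profiles `W = ω̃`, `Θ = θ̃` (`∂ᵣ = D(·)(1,0)`, `∂_z = D(·)(0,1)`). [cite: arXiv221007191, §6 (6.6) p. 53] -/
theorem IsClassicalEulerSolutionOn.chenHou_meridian_omegaTilde' (h : IsClassicalEulerSolutionOn S 0 u p)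
    (hS : UniqueDiffOn ℝ S) (hcl : S ⊆ closure (interior S)) (hu : ∀ t ∈ S, IsAxisymmetric (u t))
    {t : ℝ} (ht : t ∈ S) {q : ℝ × ℝ} (hq : 0 < q.1) :
    timeDerivWithin S (fun s q' => swirl (curl (u s)) (meridianPoint q') * (q'.1 ^ 2)⁻¹) t q +
      radialVelocity (u t) (meridianPoint q) *
        fderiv ℝ (fun q' => swirl (curl (u t)) (meridianPoint q') * (q'.1 ^ 2)⁻¹) q (1, 0) +
      axialVelocity (u t) (meridianPoint q) *
        fderiv ℝ (fun q' => swirl (curl (u t)) (meridianPoint q') * (q'.1 ^ 2)⁻¹) q (0, 1) =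
      (q.1 ^ 4)⁻¹ * fderiv ℝ (fun q' => swirl (u t) (meridianPoint q') ^ 2) q (0, 1) := by
  have hE := h.chenHou_meridian_omegaTilde hS hcl hu ht hq
  rw [fderiv_prod_apply_eq] at hE
  simpa only [smul_eq_mul, add_assoc] using hE

end Meridian

end Literature.Analysis.FluidPDE
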